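import Mathlib
import Summits.Ventures.HodgeRepro2.Tier7.Line3.DiscreteCoverLift
import Summits.Ventures.HodgeRepro2.Tier7.Line3.U11Bridge

/-!
# Tier 7 — LINE 3 support: THE NAMED ARCHIMEDEAN COVER IS A THEOREM — `(U(2) × U(1)²) × SL(2,ℝ)² → U(2) × U(1,1)²` is
continuous, surjective, open, with finite kernel (`Line3/ArchimedeanCover.lean`; t7-L1-p1, gen 6; Mathlib + x1's
`UnitaryOneOneCentre` / `U11Bridge` + p1's `T5SU11Unimodular` / `T5CayleySU11` + Line3/DiscreteCoverLift)

`DiscreteCoverLift` §6 (p685166) proved that the Poincaré series of a lattice `Γ ≤ H` is continuous on `H × H` once a cover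
`p : K₃ × SL(2,ℝ)² →* H` is given that is continuous, OPEN, surjective with finite kernel — and left «openness of the named
cover» in words (docstring ll. 30–31; `DiscreteUnitaryFactor` v2 ll. 18–19: «`U(1,1) = U(1)·SU(1,1) ≅ U(1)·SL(2,ℝ)` … in words»).
THIS FILE builds the named cover and proves the four properties, so every cover hypothesis of
`continuous_kernelSum_K₃_of_comap_three` is DISCHARGED at the model:
* §1 `U11 : Subgroup (GL (Fin 2) ℂ)` = `{g | IsU11 ↑g}` (x1's `gᴴ J g = J`, `J = diag(1, −1)`), closed (`isClosed_U11`).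
  `GL (Fin 2) ℂ` is LOCALLY COMPACT: Mathlib's units topology is induced by `Units.embedProduct : Mˣ → M × Mᵐᵒᵖ`, whose range
  `{(a, op b) | a b = 1 ∧ b a = 1}` (`range_embedProduct`) is closed, so `embedProduct` is a closed embedding
  (`isClosedEmbedding_embedProduct`, `locallyCompactSpace_GL2`); the closed subgroup `U11` is locally compact
  (`locallyCompactSpace_U11`). `T2` is Mathlib's (`Units.instT2Space`, subtypes).
* §2 the cover at one `(1,1)`-place: `scalarGL : Circle →* GL (Fin 2) ℂ` (`z ↦ z • 1`), `su11GL : SU11 →* GL (Fin 2) ℂ` (p1's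
  `SU11 ⊂ SL(2,ℂ)`, `toGL`), `coverGL := noncommCoprod scalarGL su11GL _` (scalars are central) with THE COERCION PATH stated once,
  `coe_coverGL : ↑↑(coverGL (z, s)) = (z : ℂ) • ↑↑s` (`Circle → ℂ` by `Subtype.val`, then `ℂ • M₂(ℂ)`); `coverGL_mem` is a theorem of
  `‖z‖ = 1` (x1's `isU11_smul`), not a convention; `coverU : Circle × SU11 →* U11` its codomain restriction: continuous
  (`scalarGL` by `Units.continuous_iff`, `su11GL` by `continuous_toGL`, product in the topological group), surjective (x1's
  `exists_smul_SU11`), finite kernel (`z • s = 1 ⇒ z² = det s = 1 ⇒ z = ±1`, `s = z⁻¹ • 1`: the kernel is `{(1, 1), (−1, −1)}`).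
* §3 `cayRange : SL(2, ℝ) →* SU11 := cayleyHom.rangeRestrict`: continuous, injective (p1's `cayleyConj_injective` +
  `Matrix.map_injective`), surjective; `coverV := coverU ∘ (id × cayRange)`: continuous, surjective, finite kernel.
* §4 THE FULL COVER `cover : K₃ × G₂ →* H₃`, `K₃ = U(2) × U(1) × U(1)`, `G₂ = SL(2,ℝ)²`, `H₃ := U2 × U11 × U11`,
  `(k, z₂, z₃, x₂, x₃) ↦ (k, coverV (z₂, x₂), coverV (z₃, x₃))`: `continuous_cover`, `surjective_cover`, `finite_ker_cover`,
  `sigmaCompactSpace_source` (`K₃` compact; `SL(2, ℝ)` locally compact second countable — p1's instances), `locallyCompactSpace_H₃`,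
  and **`isOpenMap_cover`** = Mathlib's OPEN MAPPING THEOREM `MonoidHom.isOpenMap_of_sigmaCompact` (σ-compact source, Baire T2
  target by `BaireSpace.of_t2Space_locallyCompactSpace`, continuous surjective hom). THE KERNEL: `Finite` is what the consumer
  takes; by §2–§3 it is `{1} × {±(1, 1)} × {±(1, 1)}` — 4 elements, the `|Z| = 4` of record — NOT stated as a theorem here; the
  count multiplicity `m = #(Γ̃ ∩ (K₃ × {1}))` of the count rows stays their DISPLAYED constant (crit-2 l. 15452 (ii)).
* §5 THE CONSUMER `continuous_kernelSum_H₃` = `continuous_kernelSum_K₃_of_comap_three` with `hp, hopen, hsurj, hker` REPLACED by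
  §4. REMAINING DISPLAYED: `Γ ≤ H₃` with `1` isolated, `f` continuous, the factorisation `f (cover g) = f₁ g.1 * (f₂ g.2.1 * f₃ g.2.2)`
  (`f₁` continuous on `K₃`), the decay `(1 + κ)^(−α)`, `α > 1`, of `f₂, f₃` on `SL(2, ℝ)` — DiscreteProductCount's binders against
  the same topologies (the subtype topology of `M₂(ℝ)` on `SL(2, ℝ)`, of `ℂ` on `Circle`, of `M₂(ℂ)` on `U(2)`): no transport.

WHAT STAYS IN WORDS (the dictionary, (a′)): that the real `U(W_A)(F_{ι₂}) ≅ U(1,1)` is THIS matrix group (form, basis), which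
`Γ ≤ H₃` is the real `Γ_N` (with `1` isolated), which `f` is the real test function. Not vacuous: `coverGL (−1, 1) ∈ U11 ≠ ⊥`,
`cover` is not injective, `Γ = ⊥` gives one continuous term. [M]-level consolidation of the [W] column (lead l. 15720 (c), l. 16047;
L1-p1 l. 15447); NOT distance to (P); residual (a′)/(b′) unchanged in kind; LEMMAS CLOSING THE STEP: 0. Nothing about (N), (P),
the real X or HC_CM. Sorry-free; axioms: propext / Classical.choice / Quot.sound. §8(d): uses an L-value-free device: NO.
-/

namespace Summit.Ventures.HodgeRepro2.Tier7.Line3.ArchimedeanCover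

open Topology
open scoped Matrix
open Summit.Ventures.HodgeRepro2.Tier7.Line3.UnitaryOneOneCentre (IsU11 J isU11_smul)
open Summit.Ventures.HodgeRepro2.T5SU11Unimodular (cayleyHom SU11 mem_SU11_iff coe_cayleyHom cayleySL coe_cayleySL)
open Summit.Ventures.HodgeRepro2.T5CayleySU11 (cayleyConj cayleyConj_injective)
open Summit.Ventures.HodgeRepro2.Tier7.Line3.DiscreteUnitaryFactor (U2 K₃ compactSpace_K₃ compactSpace_unitaryGroup)
open Summit.Ventures.HodgeRepro2.Tier7.Line3.DiscreteProductCount (G₂)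
open Summit.Ventures.HodgeRepro2.Tier7.Line3.DiscreteCoverLift
open scoped MatrixGroups

noncomputable section

/-! ## 1. `U(1,1)` as a closed subgroup of `GL₂(ℂ)`; `GL₂(ℂ)` and `U(1,1)` are locally compact -/

/-- `IsU11` is closed under products: `(gh)ᴴ J (gh) = hᴴ (gᴴ J g) h`. -/
theorem isU11_mul {g h : Matrix (Fin 2) (Fin 2) ℂ} (hg : IsU11 g) (hh : IsU11 h) : IsU11 (g * h) := by
  unfold IsU11 at *
  rw [Matrix.conjTranspose_mul]
  calc hᴴ * gᴴ * J * (g * h) = hᴴ * (gᴴ * J * g) * h := by simp only [Matrix.mul_assoc]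
    _ = J := by rw [hg, hh]

/-- `IsU11` passes to a right inverse: `hᴴ J h = hᴴ (gᴴ J g) h = (g h)ᴴ J (g h) = J`. -/
theorem isU11_of_mul_eq_one {g h : Matrix (Fin 2) (Fin 2) ℂ} (hg : IsU11 g) (hgh : g * h = 1) : IsU11 h := by
  unfold IsU11 at *
  calc hᴴ * J * h = hᴴ * (gᴴ * J * g) * h := by rw [hg]
    _ = (g * h)ᴴ * J * (g * h) := by rw [Matrix.conjTranspose_mul]; simp only [Matrix.mul_assoc]
    _ = J := by rw [hgh]; simp

/-- **`U(1,1) ⊂ GL₂(ℂ)`**: the units `g` of `M₂(ℂ)` with `gᴴ J g = J` (x1's `IsU11`, `J = diag(1, −1)`). -/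
def U11 : Subgroup (GL (Fin 2) ℂ) where
  carrier := {g | IsU11 (g : Matrix (Fin 2) (Fin 2) ℂ)}
  one_mem' := by
    show IsU11 ((1 : GL (Fin 2) ℂ) : Matrix (Fin 2) (Fin 2) ℂ)
    unfold IsU11
    simp
  mul_mem' ha hb := isU11_mul ha hb
  inv_mem' {a} ha := isU11_of_mul_eq_one ha a.mul_inv

/-- `U11` is closed in `GL₂(ℂ)`: the fibre of the continuous map `g ↦ (↑g)ᴴ J ↑g` over `J`. -/
theorem isClosed_U11 : IsClosed (U11 : Set (GL (Fin 2) ℂ)) := by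
  have : (U11 : Set (GL (Fin 2) ℂ)) =
      {g : GL (Fin 2) ℂ | (g : Matrix (Fin 2) (Fin 2) ℂ)ᴴ * J * g = J} := rfl
  rw [this]
  exact isClosed_eq ((Units.continuous_val.matrix_conjTranspose.matrix_mul continuous_const).matrix_mul
    Units.continuous_val) continuous_const

/-- the range of `Units.embedProduct` on `M₂(ℂ)`: the pairs `(a, op b)` with `a b = 1` and `b a = 1` -/
theorem range_embedProduct :
    Set.range (Units.embedProduct (Matrix (Fin 2) (Fin 2) ℂ)) =
      {p : Matrix (Fin 2) (Fin 2) ℂ × (Matrix (Fin 2) (Fin 2) ℂ)ᵐᵒᵖ |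
        p.1 * MulOpposite.unop p.2 = 1 ∧ MulOpposite.unop p.2 * p.1 = 1} := by
  ext ⟨a, b⟩
  simp only [Set.mem_range, Set.mem_setOf_eq, Units.embedProduct_apply, Prod.mk.injEq]
  constructor
  · rintro ⟨u, hu1, hu2⟩
    subst hu1
    subst hu2
    simp
  · rintro ⟨h1, h2⟩
    exact ⟨⟨a, MulOpposite.unop b, h1, h2⟩, rfl, by simp⟩

/-- that range is closed in `M₂(ℂ) × M₂(ℂ)ᵐᵒᵖ` -/
theorem isClosed_range_embedProduct :
    IsClosed (Set.range (Units.embedProduct (Matrix (Fin 2) (Fin 2) ℂ))) := by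
  rw [range_embedProduct, Set.setOf_and]
  exact (isClosed_eq (continuous_fst.mul (MulOpposite.continuous_unop.comp continuous_snd))
    continuous_const).inter
    (isClosed_eq ((MulOpposite.continuous_unop.comp continuous_snd).mul continuous_fst) continuous_const)

/-- **`GL₂(ℂ)` is locally compact**: `Units.embedProduct` is a closed embedding into `M₂(ℂ) × M₂(ℂ)ᵐᵒᵖ` (Mathlib's units
topology IS the induced one, `Units.isEmbedding_embedProduct`; the range is closed), and the target is finite-dimensional. -/
theorem locallyCompactSpace_GL2 : LocallyCompactSpace (GL (Fin 2) ℂ) :=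
  (⟨Units.isEmbedding_embedProduct, isClosed_range_embedProduct⟩ :
    IsClosedEmbedding (Units.embedProduct (Matrix (Fin 2) (Fin 2) ℂ))).locallyCompactSpace

/-- **`U(1,1)` is locally compact** (a closed subgroup of `GL₂(ℂ)`). -/
theorem locallyCompactSpace_U11 : LocallyCompactSpace U11 := by
  haveI := locallyCompactSpace_GL2
  exact isClosed_U11.isClosedEmbedding_subtypeVal.locallyCompactSpace

/-! ## 2. The cover at one `(1,1)`-place: `U(1) × SU(1,1) → U(1,1)`, `(z, s) ↦ z • s` -/

/-- the scalar `z ∈ U(1)` as the unit `z • 1 ∈ GL₂(ℂ)` (`Circle → ℂˣ → GL₂(ℂ)`) -/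
def scalarGL : Circle →* GL (Fin 2) ℂ :=
  (Units.map (algebraMap ℂ (Matrix (Fin 2) (Fin 2) ℂ)).toMonoidHom).comp Circle.toUnits

/-- the matrix of `scalarGL z` is `(z : ℂ) • 1` -/
theorem coe_scalarGL (z : Circle) :
    ((scalarGL z : GL (Fin 2) ℂ) : Matrix (Fin 2) (Fin 2) ℂ) = (z : ℂ) • (1 : Matrix (Fin 2) (Fin 2) ℂ) := by
  simp [scalarGL, Algebra.algebraMap_eq_smul_one]

/-- `SU(1,1) ⊂ SL₂(ℂ) ⊂ GL₂(ℂ)` (p1's subgroup, through `SpecialLinearGroup.toGL`) -/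
def su11GL : SU11 →* GL (Fin 2) ℂ := Matrix.SpecialLinearGroup.toGL.comp SU11.subtype

/-- the matrix of `su11GL s` is the matrix of `s` -/
theorem coe_su11GL (s : SU11) :
    ((su11GL s : GL (Fin 2) ℂ) : Matrix (Fin 2) (Fin 2) ℂ) = ((s : SL(2, ℂ)) : Matrix (Fin 2) (Fin 2) ℂ) := rfl

/-- the scalars are central: `scalarGL z` commutes with `su11GL s` -/
theorem commute_scalarGL_su11GL (z : Circle) (s : SU11) : Commute (scalarGL z) (su11GL s) :=
  Units.ext <| by
    simp only [Units.val_mul, coe_scalarGL, coe_su11GL, smul_mul_assoc, mul_smul_comm, one_mul, mul_one]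

/-- **the cover at one `(1,1)`-place, into `GL₂(ℂ)`**: `(z, s) ↦ z • s` (a homomorphism because the scalars are central). -/
def coverGL : Circle × SU11 →* GL (Fin 2) ℂ :=
  MonoidHom.noncommCoprod scalarGL su11GL commute_scalarGL_su11GL

/-- THE COERCION PATH, once: the matrix of `coverGL (z, s)` is `(z : ℂ) • ↑↑s` — `Circle → ℂ` by `Subtype.val`, then the
scalar action `ℂ • M₂(ℂ)`. -/
theorem coe_coverGL (p : Circle × SU11) :
    ((coverGL p : GL (Fin 2) ℂ) : Matrix (Fin 2) (Fin 2) ℂ) =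
      (p.1 : ℂ) • ((p.2 : SL(2, ℂ)) : Matrix (Fin 2) (Fin 2) ℂ) := by
  simp [coverGL, MonoidHom.noncommCoprod_apply, coe_scalarGL, coe_su11GL]

/-- `coverGL p ∈ U11`: a theorem of `‖z‖ = 1` (x1's `isU11_smul`) and `s ∈ SU11` (p1's `mem_SU11_iff`, x1's bridge). -/
theorem coverGL_mem (p : Circle × SU11) : coverGL p ∈ U11 := by
  show IsU11 ((coverGL p : GL (Fin 2) ℂ) : Matrix (Fin 2) (Fin 2) ℂ)
  rw [coe_coverGL]
  exact isU11_smul ((U11Bridge.isU11_iff_memU11 _).2 ((mem_SU11_iff _).1 p.2.2)) (Circle.norm_coe p.1)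

/-- **the cover at one `(1,1)`-place**: `coverU : U(1) × SU(1,1) →* U(1,1)`, `(z, s) ↦ z • s`. -/
def coverU : Circle × SU11 →* U11 := coverGL.codRestrict U11 coverGL_mem

/-- the underlying unit of `coverU p` is `coverGL p` -/
theorem coe_coverU (p : Circle × SU11) : ((coverU p : U11) : GL (Fin 2) ℂ) = coverGL p := rfl

/-- `scalarGL` is continuous (`Units.continuous_iff`: the value `(z : ℂ) • 1` and the inverse value `(z⁻¹ : ℂ) • 1`). -/
theorem continuous_scalarGL : Continuous scalarGL := by
  rw [Units.continuous_iff]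
  constructor
  · have h : (Units.val ∘ ⇑scalarGL : Circle → Matrix (Fin 2) (Fin 2) ℂ) =
        fun z : Circle => (z : ℂ) • (1 : Matrix (Fin 2) (Fin 2) ℂ) := by
      funext z
      exact coe_scalarGL z
    rw [h]
    exact (continuous_subtype_val : Continuous fun z : Circle => (z : ℂ)).smul continuous_const
  · have h : (fun z : Circle => (((scalarGL z)⁻¹ : GL (Fin 2) ℂ) : Matrix (Fin 2) (Fin 2) ℂ)) =
        fun z : Circle => ((z⁻¹ : Circle) : ℂ) • (1 : Matrix (Fin 2) (Fin 2) ℂ) := by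
      funext z
      rw [← map_inv, coe_scalarGL]
    rw [h]
    exact ((continuous_subtype_val : Continuous fun z : Circle => (z : ℂ)).comp
      (continuous_inv : Continuous fun z : Circle => z⁻¹)).smul continuous_const

/-- `su11GL` is continuous (`SpecialLinearGroup.continuous_toGL` after the subtype inclusion). -/
theorem continuous_su11GL : Continuous su11GL :=
  Matrix.SpecialLinearGroup.continuous_toGL.comp continuous_subtype_val

/-- `coverGL` is continuous: the product of two continuous homomorphisms into the topological group `GL₂(ℂ)`. -/
theorem continuous_coverGL : Continuous coverGL :=
  (continuous_scalarGL.comp continuous_fst).mul (continuous_su11GL.comp continuous_snd)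

/-- **`coverU` is continuous.** -/
theorem continuous_coverU : Continuous coverU := continuous_coverGL.subtype_mk coverGL_mem

/-- **`coverU` is surjective** = x1's `exists_smul_SU11`: every `IsU11` matrix is `z • s` with `‖z‖ = 1`, `s ∈ SU11`. -/
theorem surjective_coverU : Function.Surjective coverU := by
  rintro ⟨g, hg⟩
  obtain ⟨z, s, hz, -, hgz⟩ := U11Bridge.exists_smul_SU11 hg
  have hzc : z ∈ Submonoid.unitSphere ℂ := by
    show z ∈ Metric.sphere (0 : ℂ) 1
    exact mem_sphere_zero_iff_norm.2 hz
  refine ⟨((⟨z, hzc⟩ : Circle), s), ?_⟩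
  apply Subtype.ext
  apply Units.ext
  rw [coe_coverU, coe_coverGL]
  exact hgz.symm

/-- in the kernel of `coverU`, the scalar is `±1` and the `SU(1,1)`-component is determined by it -/
theorem smul_eq_one_of_mem_ker {p : Circle × SU11} (hp : p ∈ coverU.ker) :
    (p.1 : ℂ) • ((p.2 : SL(2, ℂ)) : Matrix (Fin 2) (Fin 2) ℂ) = 1 := by
  have h : coverU p = 1 := hp
  have h' := congrArg (fun u : U11 => ((u : GL (Fin 2) ℂ) : Matrix (Fin 2) (Fin 2) ℂ)) h
  simpa [coe_coverU, coe_coverGL] using h'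

/-- in the kernel of `coverU` the scalar is `±1` (`det (z • s) = z² det s = z²`) -/
theorem coe_eq_one_or_neg_one_of_mem_ker {p : Circle × SU11} (hp : p ∈ coverU.ker) :
    (p.1 : ℂ) = 1 ∨ (p.1 : ℂ) = -1 := by
  have h := congrArg Matrix.det (smul_eq_one_of_mem_ker hp)
  rw [Matrix.det_smul, Matrix.SpecialLinearGroup.det_coe, Matrix.det_one, Fintype.card_fin, mul_one] at h
  rw [← mul_self_eq_one_iff, ← sq]
  exact h

/-- **the kernel of `coverU` is finite** (it is `{(1, 1), (−1, −1)}`). -/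
theorem finite_ker_coverU : (coverU.ker : Set (Circle × SU11)).Finite := by
  have hinj : Set.InjOn Prod.fst (coverU.ker : Set (Circle × SU11)) := by
    intro p hp q hq hpq
    have h1 := smul_eq_one_of_mem_ker hp
    have h2 := smul_eq_one_of_mem_ker hq
    rw [← hpq] at h2
    have h3 : ((p.2 : SL(2, ℂ)) : Matrix (Fin 2) (Fin 2) ℂ) = ((q.2 : SL(2, ℂ)) : Matrix (Fin 2) (Fin 2) ℂ) :=
      smul_right_injective (Matrix (Fin 2) (Fin 2) ℂ) (Circle.coe_ne_zero p.1) (h1.trans h2.symm)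
    exact Prod.ext hpq (Subtype.ext (Subtype.ext h3))
  have himg : Prod.fst '' (coverU.ker : Set (Circle × SU11)) ⊆
      ((↑) : Circle → ℂ) ⁻¹' ({1, -1} : Set ℂ) := by
    rintro z ⟨p, hp, rfl⟩
    simp only [Set.mem_preimage, Set.mem_insert_iff, Set.mem_singleton_iff]
    exact coe_eq_one_or_neg_one_of_mem_ker hp
  exact Set.Finite.of_finite_image
    (((Set.toFinite ({1, -1} : Set ℂ)).preimage Circle.coe_injective.injOn).subset himg) hinj

/-! ## 3. The Cayley transport `SL(2, ℝ) ≅ SU(1,1)` and the cover `U(1) × SL(2, ℝ) → U(1,1)` -/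

/-- **the Cayley isomorphism onto `SU(1,1)`**: p1's `cayleyHom : SL(2, ℝ) →* SL(2, ℂ)` with its range `SU11`. -/
def cayRange : SL(2, ℝ) →* SU11 := cayleyHom.rangeRestrict

/-- `cayleySL` (conjugation by the Cayley matrix) is continuous -/
theorem continuous_cayleySL : Continuous cayleySL := by
  have h : Continuous fun g : SL(2, ℂ) => cayleyConj (g : Matrix (Fin 2) (Fin 2) ℂ) := by
    unfold Summit.Ventures.HodgeRepro2.T5CayleySU11.cayleyConj
    exact (continuous_const.matrix_mul continuous_subtype_val).matrix_mul continuous_const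
  exact h.subtype_mk _

/-- p1's `cayleyHom` is continuous -/
theorem continuous_cayleyHom : Continuous cayleyHom :=
  continuous_cayleySL.comp
    (Continuous.specialLinearGroup_map (f := Complex.ofRealHom) Complex.continuous_ofReal)

/-- **`cayRange` is continuous.** -/
theorem continuous_cayRange : Continuous cayRange := continuous_cayleyHom.subtype_mk _

/-- **`cayRange` is injective** (p1's `cayleyConj_injective`; `ofReal` is injective entrywise). -/
theorem injective_cayRange : Function.Injective cayRange := by
  intro x y hxy
  have h1 : cayleyHom x = cayleyHom y := congrArg Subtype.val hxy
  have h2 : cayleyConj (((x : SL(2, ℝ)) : Matrix (Fin 2) (Fin 2) ℝ).map Complex.ofReal) =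
      cayleyConj (((y : SL(2, ℝ)) : Matrix (Fin 2) (Fin 2) ℝ).map Complex.ofReal) := by
    have := congrArg Subtype.val h1
    simpa [coe_cayleyHom] using this
  have h3 := cayleyConj_injective h2
  exact Subtype.ext (Matrix.map_injective Complex.ofReal_injective h3)

/-- **`cayRange` is surjective** (`SU11` is the range). -/
theorem surjective_cayRange : Function.Surjective cayRange :=
  MonoidHom.rangeRestrict_surjective cayleyHom

/-- **the cover at one `(1,1)`-place from `SL(2, ℝ)`**: `coverV : U(1) × SL(2, ℝ) →* U(1,1)`, `(z, x) ↦ z • cay x`. -/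
def coverV : Circle × SL(2, ℝ) →* U11 := coverU.comp ((MonoidHom.id Circle).prodMap cayRange)

/-- **`coverV` is continuous.** -/
theorem continuous_coverV : Continuous coverV :=
  continuous_coverU.comp (continuous_id.prodMap continuous_cayRange)

/-- **`coverV` is surjective.** -/
theorem surjective_coverV : Function.Surjective coverV :=
  surjective_coverU.comp (Function.surjective_id.prodMap surjective_cayRange)

/-- **the kernel of `coverV` is finite** (the preimage of `ker coverU` under the injective `id × cayRange`). -/
theorem finite_ker_coverV : (coverV.ker : Set (Circle × SL(2, ℝ))).Finite := by
  have h : (coverV.ker : Set (Circle × SL(2, ℝ))) =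
      Prod.map id cayRange ⁻¹' (coverU.ker : Set (Circle × SU11)) := rfl
  rw [h]
  exact finite_ker_coverU.preimage (Function.injective_id.prodMap injective_cayRange).injOn

/-! ## 4. THE FULL COVER — continuous, surjective, finite kernel, OPEN -/

/-- the real archimedean group of the line: `U(2) × U(1,1) × U(1,1)` (the three archimedean places `ι₁, ι₂, ι₃`) -/
abbrev H₃ := U2 × U11 × U11

/-- **THE NAMED COVER** `(k, z₂, z₃, x₂, x₃) ↦ (k, z₂ • cay x₂, z₃ • cay x₃)`. -/
def cover : K₃ × G₂ →* H₃ where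
  toFun g := (g.1.1, coverV (g.1.2.1, g.2.1), coverV (g.1.2.2, g.2.2))
  map_one' := by
    refine Prod.ext rfl (Prod.ext ?_ ?_)
    · show coverV (1, 1) = 1
      exact map_one coverV
    · show coverV (1, 1) = 1
      exact map_one coverV
  map_mul' a b := by
    refine Prod.ext rfl (Prod.ext ?_ ?_)
    · show coverV ((a * b).1.2.1, (a * b).2.1) = coverV (a.1.2.1, a.2.1) * coverV (b.1.2.1, b.2.1)
      rw [← map_mul]
      rfl
    · show coverV ((a * b).1.2.2, (a * b).2.2) = coverV (a.1.2.2, a.2.2) * coverV (b.1.2.2, b.2.2)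
      rw [← map_mul]
      rfl

/-- **`cover` is continuous.** -/
theorem continuous_cover : Continuous cover := by
  show Continuous fun g : K₃ × G₂ => ((g.1.1, coverV (g.1.2.1, g.2.1), coverV (g.1.2.2, g.2.2)) : H₃)
  refine (continuous_fst.comp continuous_fst).prodMk (Continuous.prodMk ?_ ?_)
  · exact continuous_coverV.comp
      ((continuous_fst.comp (continuous_snd.comp continuous_fst)).prodMk (continuous_fst.comp continuous_snd))
  · exact continuous_coverV.comp
      ((continuous_snd.comp (continuous_snd.comp continuous_fst)).prodMk (continuous_snd.comp continuous_snd))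

/-- **`cover` is surjective.** -/
theorem surjective_cover : Function.Surjective cover := by
  rintro ⟨k, u, u'⟩
  obtain ⟨⟨z, x⟩, hx⟩ := surjective_coverV u
  obtain ⟨⟨z', x'⟩, hx'⟩ := surjective_coverV u'
  exact ⟨((k, z, z'), (x, x')), Prod.ext rfl (Prod.ext hx hx')⟩

/-- **the kernel of `cover` is finite** (the preimage of `{1} × ker coverV × ker coverV` under an injective rearrangement;
by §2–§3 it has exactly 4 elements — not stated). -/
theorem finite_ker_cover : (cover.ker : Set (K₃ × G₂)).Finite := by
  let φ : K₃ × G₂ → U2 × (Circle × SL(2, ℝ)) × (Circle × SL(2, ℝ)) :=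
    fun g => (g.1.1, (g.1.2.1, g.2.1), (g.1.2.2, g.2.2))
  have hφ : Function.Injective φ := by
    intro a b h
    simp only [φ, Prod.mk.injEq] at h
    obtain ⟨h1, ⟨h2, h3⟩, ⟨h4, h5⟩⟩ := h
    exact Prod.ext (Prod.ext h1 (Prod.ext h2 h4)) (Prod.ext h3 h5)
  have hsub : (cover.ker : Set (K₃ × G₂)) ⊆
      φ ⁻¹' (({1} : Set U2) ×ˢ ((coverV.ker : Set (Circle × SL(2, ℝ))) ×ˢ (coverV.ker : Set (Circle × SL(2, ℝ))))) := by
    intro g hg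
    have hg' : cover g = 1 := hg
    exact ⟨congrArg Prod.fst hg', congrArg (fun h : H₃ => h.2.1) hg', congrArg (fun h : H₃ => h.2.2) hg'⟩
  exact (((Set.finite_singleton (1 : U2)).prod (finite_ker_coverV.prod finite_ker_coverV)).preimage
    hφ.injOn).subset hsub

/-- the source `(U(2) × U(1)²) × SL(2,ℝ)²` is σ-compact (`K₃` compact; `SL(2, ℝ)` locally compact, second countable) -/
theorem sigmaCompactSpace_source : SigmaCompactSpace (K₃ × G₂) := by
  haveI := compactSpace_K₃
  infer_instance

/-- the target `U(2) × U(1,1)²` is locally compact (`U(2)` compact, `U(1,1)` locally compact) -/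
theorem locallyCompactSpace_H₃ : LocallyCompactSpace H₃ := by
  haveI := compactSpace_unitaryGroup
  haveI := locallyCompactSpace_U11
  infer_instance

/-- **THE NAMED COVER IS OPEN** — Mathlib's open mapping theorem for topological groups
(`MonoidHom.isOpenMap_of_sigmaCompact`): a continuous surjective homomorphism from a σ-compact group onto a Baire
(here: locally compact T2) group is open. -/
theorem isOpenMap_cover : IsOpenMap cover := by
  haveI := sigmaCompactSpace_source
  haveI := locallyCompactSpace_H₃
  exact MonoidHom.isOpenMap_of_sigmaCompact cover surjective_cover continuous_cover

/-! ## 5. THE CONSUMER: the real archimedean kernel is continuous, no cover hypothesis left -/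

/-- **THE REAL ARCHIMEDEAN KERNEL IS CONTINUOUS, WITH THE NAMED COVER**: `DiscreteCoverLift.continuous_kernelSum_K₃_of_comap_three`
for `cover`, its four cover binders (`hp`, `hopen`, `hsurj`, `hker`) replaced by `continuous_cover`, `isOpenMap_cover`,
`surjective_cover`, `finite_ker_cover`. What remains displayed: `Γ ≤ U(2) × U(1,1)²` with `1` isolated, `f` continuous, the
factorisation of the pull-back `f ∘ cover = f₁ ⊗ f₂ ⊗ f₃` with `f₁` continuous on `K₃`, and the decay `(1 + κ)^(−α)`, `α > 1`,
of `f₂, f₃` on `SL(2, ℝ)`; which `Γ` and which `f` are the real ones is the dictionary (a′). -/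
theorem continuous_kernelSum_H₃ {Γ : Subgroup H₃} (hΓ : IsolatedOne Γ) (f : H₃ → ℂ) (hfc : Continuous f)
    {f₁ : K₃ → ℂ} {f₂ f₃ : SL(2, ℝ) → ℂ} (hc₁ : Continuous f₁)
    (hfp : ∀ g : K₃ × G₂, f (cover g) = f₁ g.1 * (f₂ g.2.1 * f₃ g.2.2)) {C₂ C₃ α : ℝ} (hα : 1 < α)
    (h₂ : ∀ g, ‖f₂ g‖ ≤ C₂ * (1 + HyperbolicSize.κ g) ^ (-α))
    (h₃ : ∀ g, ‖f₃ g‖ ≤ C₃ * (1 + HyperbolicSize.κ g) ^ (-α)) :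
    Continuous (fun q : H₃ × H₃ => PoincareKernel.kernelSum (fun γ : Γ => (γ : H₃)) f q.1 q.2) :=
  continuous_kernelSum_K₃_of_comap_three cover continuous_cover isOpenMap_cover surjective_cover
    finite_ker_cover hΓ f hfc hc₁ hfp hα h₂ h₃

end

end Summit.Ventures.HodgeRepro2.Tier7.Line3.ArchimedeanCover
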